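import Literature.RingTheory.KTheory.KZeroField
import Mathlib.LinearAlgebra.Matrix.Kronecker
import HarnessLib

/-!
# The ring `K₀(R)` of a commutative ring: tensor product of idempotents

For a commutative ring `R`, the Kronecker (tensor) product of idempotent matrices makes
`Idem(R)` a commutative semiring, `[p'][p''] = [p' ⊗ p'']` (Husemöller–Joachim–Jurčo–Schottenloher,
Ch. 4 Def. 4.1; Thm. 4.5: under `p ↦ im p` this is `[P'][P''] = [P' ⊗_R P'']`), and the ring
completion `K₀(R) = T(Idem(R))` (Ch. 4 Constr. 1.4, Def. 4.3) a commutative ring: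

* `isIdempotentElem_kronecker`, `AlgEquivalent.kronecker` (well-definedness),
  `kronecker_comm/assoc`, `one_kronecker`, `fromBlocks_kronecker` (semiring laws up to
  algebraic equivalence, each a re-indexing);
* `Idem.tensor` (`p * q`), `Idem.map_mul`, and `CommSemiring (IdemClass R)`;
* `KZero.mulHom` (the biadditive extension), `KZero.of_mul_of : [p][q] = [p ⊗ q]`,
  **`CommRing (KZero R)`**, `of_unit_eq_natCast` (`[1ₙ] = n`), `unitHom_eq_intCast`;
* **`KZero.mapRingHom f : K₀(R) →+* K₀(S)`** (Ch. 4 Rem. 4.4: `K` is a functor to commutative rings);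
* over a field: `Idem.rank_mul` and **`KZero.rankRingEquiv : K₀(K) ≃+* ℤ`**.

Everything is proved; no named facts. For `R = C(X, ℂ)` this is the ring `K⁰(X)`; the external
product `K⁰(X) ⊗ K⁰(Y) → K⁰(X × Y)` is developed in `Literature/AlgebraicTopology/KTheory/`.

## References

* D. Husemöller, M. Joachim, B. Jurčo, M. Schottenloher, *Basic Bundle Theory and K-Cohomology
  Invariants*, LNP 726 (2008) [HusemollerEtAl2008] (held; PDF pp. 149–153): Ch. 4 Constr. 1.4
  (`T(A)` of a semiring: `[a,x]·[b,y] = [ab + xy, ay + xb]`), Def. 4.1 (`[p']·[p''] = [p' ⊗ p'']`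
  for commutative `R`), Rem. 4.2/4.4 (functoriality), Def. 4.3, Thm. 4.5 (multiplicativity of
  `im : I(R) → K(R)`).
* G. Cortiñas, in Baum et al., LNM 2008 (2011) [BaumEtAl2011]: §2.1 (4), Ex. 2.1.6.

## Design notes

* The product on `KZero R = GrothendieckAddGroup (IdemClass R)` is built by extending
  `(a, b) ↦ [a b]` biadditively with `GrothendieckAddGroup.lift` twice (`mulLeft`, `mulLeftHom`,
  `mulHom`); the ring axioms are reduced to generators with `KZero.hom_ext`.
* Commutativity of `R` is needed for `(A B) ⊗ (A' B') = (A ⊗ A')(B ⊗ B')`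
  (`Matrix.mul_kronecker_mul`).
* Mathlib searches: `Matrix.kronecker`, `mul_kronecker_mul`, `kronecker_assoc'`,
  `one_kronecker_one`, `Equiv.sumProdDistrib`, `finProdFinEquiv` (used); Mathlib's
  `GrothendieckAddGroup` has no ring structure. Nothing restated.
-/

noncomputable section

namespace Literature.RingTheory.KTheory

open Matrix Kronecker

universe u v

variable {R : Type u} [CommRing R]
variable {ι κ μ ν : Type*} [Fintype ι] [Fintype κ] [Fintype μ] [Fintype ν]

/-! ### Kronecker products of idempotents -/

/-- The Kronecker (tensor) product of idempotent matrices is idempotent. [folklore] -/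
theorem isIdempotentElem_kronecker {p : Matrix ι ι R} {q : Matrix κ κ R} (hp : IsIdempotentElem p)
    (hq : IsIdempotentElem q) : IsIdempotentElem (p ⊗ₖ q) := by
  rw [IsIdempotentElem, ← Matrix.mul_kronecker_mul, hp.eq, hq.eq]

/-- Kronecker product respects algebraic equivalence (`x ⊗ u`, `y ⊗ v`): the product
`[p][q] = [p ⊗ q]` is well defined (Husemöller et al., Ch. 4 Def. 4.1, Thm. 4.5).
[cite: HusemollerEtAl2008, Ch. 4 Def. 4.1] -/
theorem AlgEquivalent.kronecker {p : Matrix ι ι R} {p' : Matrix μ μ R} {q : Matrix κ κ R} {q' : Matrix ν ν R}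
    (h₁ : AlgEquivalent p p') (h₂ : AlgEquivalent q q') : AlgEquivalent (p ⊗ₖ q) (p' ⊗ₖ q') := by
  have hp := isIdempotentElem_kronecker h₁.isIdempotentElem_left h₂.isIdempotentElem_left
  have hp' := isIdempotentElem_kronecker h₁.isIdempotentElem_right h₂.isIdempotentElem_right
  obtain ⟨x, y, rfl, rfl, -, -⟩ := h₁
  obtain ⟨u, v, rfl, rfl, -, -⟩ := h₂
  exact AlgEquivalent.of_mul_eq hp hp' (x := x ⊗ₖ u) (y := y ⊗ₖ v) (Matrix.mul_kronecker_mul _ _ _ _).symm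
    (Matrix.mul_kronecker_mul _ _ _ _).symm

omit [Fintype ι] [Fintype κ] in
/-- Swapping the factors of a Kronecker product over a commutative ring is a re-indexing. [folklore] -/
theorem kronecker_submatrix_swap (p : Matrix ι ι R) (q : Matrix κ κ R) :
    (p ⊗ₖ q).submatrix Prod.swap Prod.swap = q ⊗ₖ p := by
  ext ⟨i, j⟩ ⟨i', j'⟩
  simp [mul_comm]

/-- `p ⊗ q ∼ q ⊗ p`. [cite: HusemollerEtAl2008, Ch. 4 Def. 4.1] -/
theorem AlgEquivalent.kronecker_comm {p : Matrix ι ι R} {q : Matrix κ κ R} (hp : IsIdempotentElem p)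
    (hq : IsIdempotentElem q) : AlgEquivalent (p ⊗ₖ q) (q ⊗ₖ p) := by
  simpa [kronecker_submatrix_swap] using
    AlgEquivalent.submatrix (isIdempotentElem_kronecker hp hq) (Equiv.prodComm κ ι)

/-- `(p ⊗ q) ⊗ r ∼ p ⊗ (q ⊗ r)`. [cite: HusemollerEtAl2008, Ch. 4 Def. 4.1] -/
theorem AlgEquivalent.kronecker_assoc {p : Matrix ι ι R} {q : Matrix κ κ R} {r : Matrix μ μ R}
    (hp : IsIdempotentElem p) (hq : IsIdempotentElem q) (hr : IsIdempotentElem r) :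
    AlgEquivalent (p ⊗ₖ q ⊗ₖ r) (p ⊗ₖ (q ⊗ₖ r)) := by
  simpa using AlgEquivalent.submatrix (isIdempotentElem_kronecker (isIdempotentElem_kronecker hp hq) hr)
    (Equiv.prodAssoc ι κ μ).symm

omit [Fintype ι] in
/-- `1₁ ⊗ p` re-indexed along `Unit × ι ≃ ι` is `p`. [folklore] -/
theorem one_kronecker_submatrix (p : Matrix ι ι R) :
    ((1 : Matrix (Fin 1) (Fin 1) R) ⊗ₖ p).submatrix (fun i ↦ ((0 : Fin 1), i)) (fun i ↦ ((0 : Fin 1), i)) = p := by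
  ext i j; simp

/-- `1₁ ⊗ p ∼ p`. [cite: HusemollerEtAl2008, Ch. 4 Def. 4.1] -/
theorem AlgEquivalent.one_kronecker {p : Matrix ι ι R} (hp : IsIdempotentElem p) :
    AlgEquivalent ((1 : Matrix (Fin 1) (Fin 1) R) ⊗ₖ p) p := by
  have h := AlgEquivalent.submatrix (isIdempotentElem_kronecker IsIdempotentElem.one hp)
    ((Equiv.uniqueProd ι (Fin 1)).symm)
  convert h using 2
  exact (one_kronecker_submatrix p).symm

omit [Fintype ι] [Fintype κ] [Fintype μ] in
/-- Distributivity of `⊗` over block sums is a re-indexing. [folklore] -/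
theorem fromBlocks_kronecker_submatrix (p : Matrix ι ι R) (q : Matrix κ κ R) (r : Matrix μ μ R) :
    ((Matrix.fromBlocks p 0 0 q) ⊗ₖ r).submatrix (Equiv.sumProdDistrib ι κ μ).symm (Equiv.sumProdDistrib ι κ μ).symm =
      Matrix.fromBlocks (p ⊗ₖ r) 0 0 (q ⊗ₖ r) := by
  ext (⟨i, k⟩ | ⟨j, k⟩) (⟨i', k'⟩ | ⟨j', k'⟩) <;> simp

/-- `(p ⊕ q) ⊗ r ∼ (p ⊗ r) ⊕ (q ⊗ r)`. [cite: HusemollerEtAl2008, Ch. 4 Def. 4.1] -/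
theorem AlgEquivalent.fromBlocks_kronecker {p : Matrix ι ι R} {q : Matrix κ κ R} {r : Matrix μ μ R}
    (hp : IsIdempotentElem p) (hq : IsIdempotentElem q) (hr : IsIdempotentElem r) :
    AlgEquivalent ((Matrix.fromBlocks p 0 0 q) ⊗ₖ r) (Matrix.fromBlocks (p ⊗ₖ r) 0 0 (q ⊗ₖ r)) := by
  have h := AlgEquivalent.submatrix (isIdempotentElem_kronecker (isIdempotentElem_fromBlocks hp hq) hr)
    (Equiv.sumProdDistrib ι κ μ).symm
  rwa [fromBlocks_kronecker_submatrix] at h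

/-! ### The product on `Idem R` and the commutative semiring `Idem(R)` -/

namespace Idem

/-- Tensor product `p ⊗ q ∈ M_{mn}(R)` of idempotent matrices (Kronecker product re-indexed
along `Fin m × Fin n ≃ Fin (m n)`); it induces the product of `Idem(R)` and `K₀(R)`.
[cite: HusemollerEtAl2008, Ch. 4 Def. 4.1] -/
def tensor (p q : Idem R) : Idem R where
  size := p.size * q.size
  mat := Matrix.reindex finProdFinEquiv finProdFinEquiv (p.mat ⊗ₖ q.mat)
  isIdempotentElem := isIdempotentElem_submatrix (isIdempotentElem_kronecker p.isIdempotentElem q.isIdempotentElem) _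

/-- `p * q` on `Idem R` is the tensor product. -/
instance : Mul (Idem R) := ⟨tensor⟩

/-- `1` on `Idem R` is `1₁` (the free module `R`). -/
instance : One (Idem R) := ⟨unit 1⟩

/-- `1 = 1₁` in `Idem R`. [folklore] -/
theorem one_def : (1 : Idem R) = unit 1 := rfl

/-- The tensor product, unfolded. [folklore] -/
theorem mul_mat (p q : Idem R) : (p * q).mat = Matrix.reindex finProdFinEquiv finProdFinEquiv (p.mat ⊗ₖ q.mat) := rfl

/-- Sizes multiply under tensor product. [folklore] -/
@[simp] theorem mul_size (p q : Idem R) : (p * q).size = p.size * q.size := rfl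

/-- `p * q` is algebraically equivalent to the plain Kronecker product. [folklore] -/
theorem mul_equiv_kronecker (p q : Idem R) : AlgEquivalent (p * q).mat (p.mat ⊗ₖ q.mat) :=
  (AlgEquivalent.reindex (isIdempotentElem_kronecker p.isIdempotentElem q.isIdempotentElem) _).symm

/-- Tensor product respects algebraic equivalence. [cite: HusemollerEtAl2008, Ch. 4 Def. 4.1] -/
theorem mul_congr {p p' q q' : Idem R} (hp : p ≈ p') (hq : q ≈ q') : p * q ≈ p' * q' :=
  (mul_equiv_kronecker p q).trans ((AlgEquivalent.kronecker hp hq).trans (mul_equiv_kronecker p' q').symm)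

/-- Tensor product is commutative up to equivalence. [cite: HusemollerEtAl2008, Ch. 4 Def. 4.1] -/
theorem mul_comm_equiv (p q : Idem R) : p * q ≈ q * p :=
  (mul_equiv_kronecker p q).trans
    ((AlgEquivalent.kronecker_comm p.isIdempotentElem q.isIdempotentElem).trans (mul_equiv_kronecker q p).symm)

/-- Tensor product is associative up to equivalence. [cite: HusemollerEtAl2008, Ch. 4 Def. 4.1] -/
theorem mul_assoc_equiv (p q r : Idem R) : p * q * r ≈ p * (q * r) :=
  (mul_equiv_kronecker (p * q) r).trans <|
    ((mul_equiv_kronecker p q).kronecker (AlgEquivalent.refl r.isIdempotentElem)).trans <|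
      (AlgEquivalent.kronecker_assoc p.isIdempotentElem q.isIdempotentElem r.isIdempotentElem).trans <|
        ((AlgEquivalent.refl p.isIdempotentElem).kronecker (mul_equiv_kronecker q r).symm).trans
          (mul_equiv_kronecker p (q * r)).symm

/-- `1₁ ⊗ p ≈ p`. [cite: HusemollerEtAl2008, Ch. 4 Def. 4.1] -/
theorem one_mul_equiv (p : Idem R) : 1 * p ≈ p :=
  (mul_equiv_kronecker 1 p).trans (AlgEquivalent.one_kronecker p.isIdempotentElem)

/-- `p ⊗ 1₁ ≈ p`. [cite: HusemollerEtAl2008, Ch. 4 Def. 4.1] -/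
theorem mul_one_equiv (p : Idem R) : p * 1 ≈ p := (mul_comm_equiv p 1).trans (one_mul_equiv p)

/-- `(p ⊕ q) ⊗ r ≈ p ⊗ r ⊕ q ⊗ r`. [cite: HusemollerEtAl2008, Ch. 4 Def. 4.1] -/
theorem add_mul_equiv (p q r : Idem R) : (p + q) * r ≈ p * r + q * r :=
  (mul_equiv_kronecker (p + q) r).trans <|
    ((add_equiv_fromBlocks p q).kronecker (AlgEquivalent.refl r.isIdempotentElem)).trans <|
      (AlgEquivalent.fromBlocks_kronecker p.isIdempotentElem q.isIdempotentElem r.isIdempotentElem).trans <|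
        (((mul_equiv_kronecker p r).symm).fromBlocks (mul_equiv_kronecker q r).symm).trans
          (add_equiv_fromBlocks (p * r) (q * r)).symm

/-- `p ⊗ (q ⊕ r) ≈ p ⊗ q ⊕ p ⊗ r`. [cite: HusemollerEtAl2008, Ch. 4 Def. 4.1] -/
theorem mul_add_equiv (p q r : Idem R) : p * (q + r) ≈ p * q + p * r :=
  (mul_comm_equiv p (q + r)).trans <| (add_mul_equiv q r p).trans (add_congr (mul_comm_equiv q p) (mul_comm_equiv r p))

/-- `0 ⊗ p ≈ 0`. [cite: HusemollerEtAl2008, Ch. 4 Def. 4.1] -/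
theorem zero_mul_equiv (p : Idem R) : 0 * p ≈ 0 := by
  refine (mul_equiv_kronecker 0 p).trans ?_
  rw [show (0 : Idem R).mat = 0 from rfl, Matrix.zero_kronecker]
  exact AlgEquivalent.zero_zero

/-- `p ⊗ 0 ≈ 0`. [cite: HusemollerEtAl2008, Ch. 4 Def. 4.1] -/
theorem mul_zero_equiv (p : Idem R) : p * 0 ≈ 0 := (mul_comm_equiv p 0).trans (zero_mul_equiv p)

/-- `Idem.map` is multiplicative (on the nose). [cite: HusemollerEtAl2008, Ch. 4 Rem. 4.2] -/
theorem map_mul {S : Type v} [CommRing S] (f : R →+* S) (p q : Idem R) : (p * q).map f = p.map f * q.map f :=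
  mk_eq_mk_of_eq _ _ <| by
    change ((Matrix.reindex _ _) (p.mat ⊗ₖ q.mat)).map f = Matrix.reindex _ _ ((p.mat.map f) ⊗ₖ (q.mat.map f))
    rw [Matrix.reindex_apply, Matrix.reindex_apply, ← Matrix.submatrix_map]
    congr 1
    ext ⟨i, j⟩ ⟨i', j'⟩
    simp

/-- `Idem.map` preserves `1`. [cite: HusemollerEtAl2008, Ch. 4 Rem. 4.2] -/
theorem map_one {S : Type v} [CommRing S] (f : R →+* S) : (1 : Idem R).map f = 1 :=
  mk_eq_mk_of_eq _ _ (Matrix.map_one f (_root_.map_zero f) (_root_.map_one f))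

end Idem

namespace IdemClass

/-- Multiplication on `Idem(R)`: `[p][q] = [p ⊗ q]`. -/
instance : Mul (IdemClass R) := ⟨Quotient.map₂ (· * ·) fun _ _ hp _ _ hq ↦ Idem.mul_congr hp hq⟩

/-- The unit of `Idem(R)`: `[1₁] = [R]`. -/
instance : One (IdemClass R) := ⟨mk 1⟩

/-- `[p][q] = [p ⊗ q]` in `Idem(R)`. [cite: HusemollerEtAl2008, Ch. 4 Def. 4.1] -/
theorem mk_mul_mk (p q : Idem R) : mk p * mk q = mk (p * q) := rfl

/-- `[1₁] = 1` in `Idem(R)`. [cite: HusemollerEtAl2008, Ch. 4 Def. 4.1] -/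
theorem mk_one : mk (1 : Idem R) = 1 := rfl

/-- **`Idem(R)` is a commutative semiring** under block sum and tensor product for commutative
`R` (Husemöller et al., Ch. 4 Def. 4.1). [cite: HusemollerEtAl2008, Ch. 4 Def. 4.1] -/
instance : CommSemiring (IdemClass R) :=
  { (inferInstance : AddCommMonoid (IdemClass R)), (inferInstance : Mul (IdemClass R)),
    (inferInstance : One (IdemClass R)) with
    mul_assoc := by rintro ⟨p⟩ ⟨q⟩ ⟨r⟩; exact Quotient.sound (Idem.mul_assoc_equiv p q r)
    one_mul := by rintro ⟨p⟩; exact Quotient.sound (Idem.one_mul_equiv p)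
    mul_one := by rintro ⟨p⟩; exact Quotient.sound (Idem.mul_one_equiv p)
    zero_mul := by rintro ⟨p⟩; exact Quotient.sound (Idem.zero_mul_equiv p)
    mul_zero := by rintro ⟨p⟩; exact Quotient.sound (Idem.mul_zero_equiv p)
    left_distrib := by rintro ⟨p⟩ ⟨q⟩ ⟨r⟩; exact Quotient.sound (Idem.mul_add_equiv p q r)
    right_distrib := by rintro ⟨p⟩ ⟨q⟩ ⟨r⟩; exact Quotient.sound (Idem.add_mul_equiv p q r)
    mul_comm := by rintro ⟨p⟩ ⟨q⟩; exact Quotient.sound (Idem.mul_comm_equiv p q) }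

end IdemClass

namespace KZero

/-! ### The commutative ring `K₀(R)` -/

/-- Left multiplication by a class of `Idem(R)` on `K₀(R)` (additive extension). [folklore] -/
def mulLeft (a : IdemClass R) : KZero R →+ KZero R :=
  Algebra.GrothendieckAddGroup.lift ((Algebra.GrothendieckAddGroup.of (M := IdemClass R)).comp (AddMonoidHom.mulLeft a))

/-- `mulLeft a [q] = [a [q]]`. [folklore] -/
theorem mulLeft_of (a : IdemClass R) (q : Idem R) :
    mulLeft a (of q) = Algebra.GrothendieckAddGroup.of (a * IdemClass.mk q) := by
  rw [mulLeft, lift_of]; rfl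

/-- `a ↦ (x ↦ a x)` is additive in `a`. [folklore] -/
def mulLeftHom : IdemClass R →+ (KZero R →+ KZero R) where
  toFun := mulLeft
  map_zero' := hom_ext fun q ↦ by rw [mulLeft_of, zero_mul, map_zero]; rfl
  map_add' a b := hom_ext fun q ↦ by
    rw [mulLeft_of, AddMonoidHom.add_apply, mulLeft_of, mulLeft_of, add_mul, map_add]

/-- The product of `K₀(R)` as a biadditive map (the ring structure of the Grothendieck
construction `T(Idem(R))`, Husemöller et al., Ch. 4 Constr. 1.4: `[a,x]·[b,y] = [ab + xy, ay + xb]`).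
[cite: HusemollerEtAl2008, Ch. 4 Constr. 1.4] -/
def mulHom : KZero R →+ (KZero R →+ KZero R) := Algebra.GrothendieckAddGroup.lift mulLeftHom

/-- `mulHom [p] [q] = [p ⊗ q]`. [folklore] -/
theorem mulHom_of_of (p q : Idem R) : mulHom (of p) (of q) = of (p * q) := by
  rw [mulHom, lift_of]
  change mulLeft (IdemClass.mk p) (of q) = of (p * q)
  rw [mulLeft_of]; rfl

/-- Multiplication on `K₀(R)`. -/
instance : Mul (KZero R) := ⟨fun x y ↦ mulHom x y⟩

/-- The unit `[R] = [1₁]` of `K₀(R)`. -/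
instance : One (KZero R) := ⟨of 1⟩

/-- Multiplication of `K₀(R)` is `mulHom`. [folklore] -/
theorem mul_def (x y : KZero R) : x * y = mulHom x y := rfl

/-- `1 = [1₁]` in `K₀(R)`. [folklore] -/
theorem one_def : (1 : KZero R) = of 1 := rfl

/-- `[p] [q] = [p ⊗ q]`. [cite: HusemollerEtAl2008, Ch. 4 Def. 4.1] -/
theorem of_mul_of (p q : Idem R) : of p * of q = of (p * q) := mulHom_of_of p q

/-- `[1₁] = 1`. [cite: HusemollerEtAl2008, Ch. 4 Def. 4.1] -/
theorem of_one : of (1 : Idem R) = 1 := rfl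

/-- **`K₀(R)` is a commutative ring** for commutative `R` (the ring completion `T(Idem(R))` of the
commutative semiring `Idem(R)`, Husemöller et al., Ch. 4 Constr. 1.4 and Def. 4.3).
[cite: HusemollerEtAl2008, Ch. 4 Def. 4.3] -/
instance : CommRing (KZero R) :=
  { (inferInstance : AddCommGroup (KZero R)), (inferInstance : Mul (KZero R)),
    (inferInstance : One (KZero R)) with
    left_distrib := fun a b c ↦ map_add (mulHom a) b c
    right_distrib := fun a b c ↦ by
      change mulHom (a + b) c = mulHom a c + mulHom b c
      rw [map_add]; rfl
    zero_mul := fun a ↦ by change mulHom 0 a = 0; rw [map_zero]; rfl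
    mul_zero := fun a ↦ map_zero (mulHom a)
    mul_assoc := fun a b c ↦ by
      -- reduce to generators, one variable at a time
      have h₁ : ∀ (p q : Idem R) (c : KZero R), of p * of q * c = of p * (of q * c) := fun p q ↦ by
        refine fun c ↦ DFunLike.congr_fun (hom_ext (g₁ := mulHom (of p * of q))
          (g₂ := (mulHom (of p)).comp (mulHom (of q))) fun r ↦ ?_) c
        change of p * of q * of r = of p * (of q * of r)
        rw [of_mul_of, of_mul_of, of_mul_of, of_mul_of]
        exact of_eq_of (Idem.mul_assoc_equiv p q r)
      have h₂ : ∀ (p : Idem R) (b c : KZero R), of p * b * c = of p * (b * c) := fun p b c ↦ by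
        refine DFunLike.congr_fun (hom_ext (g₁ := (mulHom.flip c).comp (mulHom (of p)))
          (g₂ := (mulHom (of p)).comp (mulHom.flip c)) fun q ↦ ?_) b
        exact h₁ p q c
      refine DFunLike.congr_fun (hom_ext (g₁ := (mulHom.flip c).comp (mulHom.flip b))
        (g₂ := mulHom.flip (b * c)) fun p ↦ ?_) a
      exact h₂ p b c
    one_mul := fun a ↦ DFunLike.congr_fun (hom_ext (g₁ := mulHom (of 1)) (g₂ := AddMonoidHom.id _) fun p ↦ by
      change of 1 * of p = of p
      rw [of_mul_of]; exact of_eq_of (Idem.one_mul_equiv p)) a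
    mul_one := fun a ↦ DFunLike.congr_fun (hom_ext (g₁ := mulHom.flip (of 1)) (g₂ := AddMonoidHom.id _) fun p ↦ by
      change of p * of 1 = of p
      rw [of_mul_of]; exact of_eq_of (Idem.mul_one_equiv p)) a
    mul_comm := fun a b ↦ by
      refine DFunLike.congr_fun (DFunLike.congr_fun (hom_ext (g₁ := mulHom) (g₂ := mulHom.flip) fun p ↦
        hom_ext fun q ↦ ?_) a) b
      change of p * of q = of q * of p
      rw [of_mul_of, of_mul_of]; exact of_eq_of (Idem.mul_comm_equiv p q) }

/-- `[1ₙ] = n` in the ring `K₀(R)`. [cite: BaumEtAl2011, §2.1 eq. (4)] -/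
theorem of_unit_eq_natCast (n : ℕ) : of (Idem.unit n : Idem R) = (n : KZero R) := by
  rw [of_unit, nsmul_eq_mul, ← Idem.one_def, of_one, mul_one]

/-- `unitHom n = n`. [cite: BaumEtAl2011, §2.1 eq. (4)] -/
theorem unitHom_eq_intCast (n : ℤ) : unitHom R n = (n : KZero R) := by
  rw [unitHom_apply, ← Idem.one_def, of_one, zsmul_eq_mul, mul_one]

/-! ### Functoriality: `K₀(f)` is a ring homomorphism -/

/-- **`K₀(f)` is a ring homomorphism** for a homomorphism of commutative rings.
[cite: HusemollerEtAl2008, Ch. 4 Rem. 4.4] -/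
def mapRingHom {S : Type v} [CommRing S] (f : R →+* S) : KZero R →+* KZero S :=
  { map f with
    map_one' := by rw [one_def, AddMonoidHom.toFun_eq_coe, map_of, Idem.map_one, one_def]
    map_mul' := fun a b ↦ by
      simp only [AddMonoidHom.toFun_eq_coe]
      refine DFunLike.congr_fun (DFunLike.congr_fun (hom_ext (g₁ := (AddMonoidHom.compr₂ mulHom (map f)))
        (g₂ := (mulHom.comp (map f)).compl₂ (map f)) fun p ↦ hom_ext fun q ↦ ?_) a) b
      change map f (of p * of q) = map f (of p) * map f (of q)
      rw [of_mul_of, map_of, map_of, map_of, of_mul_of, Idem.map_mul] }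

/-- `mapRingHom f` is `map f` as a function. [cite: HusemollerEtAl2008, Ch. 4 Rem. 4.4] -/
@[simp] theorem mapRingHom_apply {S : Type v} [CommRing S] (f : R →+* S) (a : KZero R) :
    mapRingHom f a = map f a := rfl

end KZero

/-! ### Over a field the rank is a ring isomorphism `K₀(K) ≃+* ℤ` -/

section Field

variable {K : Type u} [Field K]

/-- The rank is multiplicative: `rank (p ⊗ q) = rank p · rank q`. [cite: BaumEtAl2011, §2.1 Ex. 2.1.6] -/
theorem Idem.rank_mul (p q : Idem K) : (p * q).rank = p.rank * q.rank := by
  rw [Idem.rank_eq_iff]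
  have h := Idem.mul_congr p.equiv_unit_rank q.equiv_unit_rank
  refine h.trans ?_
  have : (Idem.unit p.rank * Idem.unit q.rank : Idem K) = Idem.unit (p.rank * q.rank) :=
    Idem.mk_eq_mk_of_eq _ _ (by
      change Matrix.reindex finProdFinEquiv finProdFinEquiv ((1 : Matrix (Fin p.rank) (Fin p.rank) K) ⊗ₖ
        (1 : Matrix (Fin q.rank) (Fin q.rank) K)) = 1
      rw [Matrix.one_kronecker_one, Matrix.reindex_apply, Matrix.submatrix_one_equiv])
  rw [this]
  exact Setoid.refl (Idem.unit (p.rank * q.rank))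

/-- **`K₀` of a field is `ℤ` as a ring**, by the rank. [cite: BaumEtAl2011, §2.1 Ex. 2.1.6] -/
def KZero.rankRingEquiv : KZero K ≃+* ℤ :=
  { KZero.rankEquiv with
    map_mul' := fun a b ↦ by
      simp only [AddEquiv.toEquiv_eq_coe, Equiv.toFun_as_coe, EquivLike.coe_coe]
      refine DFunLike.congr_fun (DFunLike.congr_fun (KZero.hom_ext
        (g₁ := AddMonoidHom.compr₂ KZero.mulHom KZero.rankEquiv.toAddMonoidHom)
        (g₂ := ((AddMonoidHom.mul : ℤ →+ ℤ →+ ℤ).comp KZero.rankEquiv.toAddMonoidHom).compl₂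
          KZero.rankEquiv.toAddMonoidHom) fun p ↦ KZero.hom_ext fun q ↦ ?_) a) b
      change KZero.rankEquiv (KZero.of p * KZero.of q) = KZero.rankEquiv (KZero.of p) * KZero.rankEquiv (KZero.of q)
      rw [KZero.of_mul_of, KZero.rankEquiv_of, KZero.rankEquiv_of, KZero.rankEquiv_of, Idem.rank_mul, Nat.cast_mul] }

/-- `rankRingEquiv` is `rankEquiv` as a function. [cite: BaumEtAl2011, §2.1 Ex. 2.1.6] -/
@[simp] theorem KZero.rankRingEquiv_apply (a : KZero K) : KZero.rankRingEquiv a = KZero.rankEquiv a := rfl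

end Field

end Literature.RingTheory.KTheory

end
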